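/-
Copyright (c) 2026 the pub-hodgecm-mathlib formalisation cell (harness21).  Prover seat hodgecm-mathlib-A-p19 (g27), 2026-09-02.  Road «S3-tree»∕«S3-ram» (LEAD F0P3a-plan (g12)
T11-41∕T11-52; owner p06 (g15)), row (e2) «P-2-ram», organ «(D2-β)-ram, part D: THE BASE NORM DICTIONARY OF A TAME-RAMIFIED QUADRATIC PLACE IN VALUATION CURRENCY» — the
base-field hypotheses (`hsres hdres hsqF hU1F hnormF hprinc hdnn hvalF hfixval`) of ★ `UnramifiedQuadraticDictionaryNorms` ∕ ★ `UnramifiedQuadraticNormTransferTypeB` ∕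
`…TypeA` DISCHARGED at a ramified non-split place from ★ `RamifiedPlaceUnitNorms` (U1)–(U3) and ★ `RamifiedPlaceAntiFixedUniformizer`.
-/
import Literature.NumberTheory.LocalFields.RamifiedPlaceUnitNorms             -- ★ p846833 (U1) criterion, (U2) the non-norm unit `η`, (U3) the dichotomy, `valued_eq_one_of_mul_…`
import Literature.NumberTheory.Automorphic.RamifiedPlaceAntiFixedUniformizer   -- ★ anti-fixed uniformiser `ϖ`, `odd_log_valued_of_galAdicCompletionMap_eq_neg`; brings ★ `valued_galAdicCompletionMap_sub_lt_one_of_ramified`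
import HarnessLib

/-!
# The norm dictionary of a tamely ramified quadratic place in valuation currency (Serre, *Local Fields* V §3 Prop. 5, Cor. 2; Neukirch V (1.2))

Topic `NumberTheory/LocalFields`; namespace `Literature.NumberTheory.LocalFields.RamifiedPlaceNormDictionary`.  THEOREMS ONLY (no definition, no instance, no notation, no named
fact, no `sorry`); kernel lane `--supports stmt-HodgeConjecture-24833`.  Cell `pub/hodgecm-mathlib` (D-0151), crux H413; road «S3-tree», seeding wave «S3-ram», row (e2) «P-2-ram»;
organ **«(D2-β)-ram, part D»** (this seat).  Frame: `E ∕ F` a quadratic extension of number fields, `c ≠ 1`, `w ∣ v` with `c • w = w`, RAMIFIED (`e(w|v) ≠ 1`) and TAME (`|2|_w = 1`);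
`σ := σ_w = galAdicCompletionMap c hw` on `E_w`.  The abstract base hypotheses of the (D2-β)-ram dictionaries (stated there for an involution `s` of a local field `F_v` with a
fixed non-square-residue unit `d` and an anti-fixed `ϖ`) are facts of `(E_w, σ_w, η, ϖ)` with `η` the fixed non-norm unit of ★ (U2) `exists_fixed_unit_not_norm_of_ramified` and
`ϖ` the anti-fixed uniformiser of ★ `exists_uniformizer_galAdicCompletionMap_eq_neg_of_ramified`:

* §1 residues in valuation currency: **`isSquare_residue_iff_exists_valued_sub_sq_lt_one`** (`ū ∈ 𝓀²  ↔ ∃ r ∈ 𝒪, |u − r²| < 1`), hence `hdres` for `η`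
  (**`not_valued_sub_sq_lt_one_of_not_isSquare_residue`**).
* §2 units: **`exists_mul_galAdicCompletionMap_eq_iff_exists_valued_sub_sq_lt_one_of_ramified`** (`hU1F`, from (U1)), **`exists_valued_sub_sq_lt_one_or_of_ramified`** (`hsqF`:
  every unit is residually `r²` or `r²η`, from (U3) applied to the fixed unit `(g + σg)∕2 ≡ g`), **`exists_mul_galAdicCompletionMap_eq_of_valued_sub_one_lt_one_of_ramified`**
  (`hprinc`: fixed principal units are norms).
* §3 valuations: **`even_log_valued_of_galAdicCompletionMap_eq_of_ramified`** (fixed ⇒ even order, from ★ odd-order of anti-fixed applied to `p·ϖ`),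
  **`exists_valued_eq_zpow_two_mul_of_galAdicCompletionMap_eq_of_ramified`** (`hvalF`: `|p| = |ϖ|^{2k}`), **`exists_valued_eq_zpow_two_mul_add_one_of_galAdicCompletionMap_eq_neg_of_ramified`**
  (anti-fixed: `|q| = |ϖ|^{2k+1}`), **`valued_ne_of_galAdicCompletionMap_eq_of_eq_neg_of_ramified`** (`hfixval`).
* §4 the non-zero fixed elements: **`exists_mul_galAdicCompletionMap_mul_eq_one_or_eq_of_ramified`** (`hnormF`: `f ≠ 0` fixed ⇒ `∃ z, z·σz·f ∈ {1, η}`, via `f·(ϖσϖ)^j` a fixed unit and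
  (U3)).  HONEST LABEL: HC_CM is proved only modulo the 2 remaining named inputs (hLiu418 24832, h413 24833) until rung 0 closes; local algebra, count-neutral.

## References
* [SerreLocalFields1979] J.-P. Serre, *Local Fields*, GTM 67 (1979): Ch. V §3 Prop. 5 and Cor. 2 (tamely ramified quadratic: `F^× ∕ N E^×` of order `2`, units: residue squares),
  Ch. IV §2 Prop. 5, Ch. II §4 Prop. 7.
* [Neukirch1999] J. Neukirch, *Algebraic Number Theory*, Grundlehren 322 (1999): Ch. V (1.2), Ch. II (4.3).
-/

set_option autoImplicit false

noncomputable section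

open NumberField IsDedekindDomain ValuativeRel
open scoped ValuativeRel
open Literature.NumberTheory.Automorphic Literature.NumberTheory.Automorphic.UnitaryGroup
open Literature.NumberTheory.LocalFields.RamifiedPlaceUnitNorms
open Literature.NumberTheory.Automorphic.Liu2021.LemD1IndexedNonVacuityRamifiedConverse (valued_galAdicCompletionMap_sub_lt_one_of_ramified)

namespace Literature.NumberTheory.LocalFields.RamifiedPlaceNormDictionary

variable {F : Type} (E : Type) [Field F] [NumberField F] [Field E] [NumberField E] [Algebra F E] [Algebra.IsQuadraticExtension F E]
  (c : E ≃ₐ[F] E) (hc : c ≠ 1) (v : HeightOneSpectrum (𝓞 F)) (w : PlacesOver E v) (hw : c • w.1 = w.1)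

/-! ## §1 Residue squares in valuation currency -/

omit [NumberField F] [Algebra.IsQuadraticExtension F E] in
/-- **`ū` is a square in `𝓀_w` iff `|u − r²|_w < 1` for some `r ∈ 𝒪[E_w]`** (`|u|_w = 1`). [cite: SerreLocalFields1979, Ch. II §4 Prop. 7] -/
theorem isSquare_residue_iff_exists_valued_sub_sq_lt_one {u : w.1.adicCompletion E} (hu1 : Valued.v u = 1) :
    IsSquare (IsLocalRing.residue 𝒪[w.1.adicCompletion E] ⟨u, (v_le_one_iff_mem_integer u).1 hu1.le⟩) ↔
      ∃ r : w.1.adicCompletion E, Valued.v r ≤ 1 ∧ Valued.v (u - r ^ 2) < 1 := by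
  have hmem : ∀ x : 𝒪[w.1.adicCompletion E], x ∈ IsLocalRing.maximalIdeal 𝒪[w.1.adicCompletion E] ↔ Valued.v (x : w.1.adicCompletion E) < 1 := fun x => by
    rw [← IsLocalRing.residue_eq_zero_iff, residue_eq_zero_iff_valuation_lt_one, v_lt_one_iff_valuation_lt_one]
  set uO : 𝒪[w.1.adicCompletion E] := ⟨u, (v_le_one_iff_mem_integer u).1 hu1.le⟩ with huO
  constructor
  · rintro ⟨tbar, ht⟩
    obtain ⟨tO, rfl⟩ := IsLocalRing.residue_surjective tbar
    refine ⟨tO, (v_le_one_iff_mem_integer (tO : w.1.adicCompletion E)).2 tO.2, ?_⟩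
    have h0 : IsLocalRing.residue 𝒪[w.1.adicCompletion E] (uO - tO * tO) = 0 := by rw [map_sub, map_mul, ht, sub_self]
    rw [IsLocalRing.residue_eq_zero_iff, hmem] at h0
    have hcoe : (((uO - tO * tO : 𝒪[w.1.adicCompletion E])) : w.1.adicCompletion E) = u - (tO : w.1.adicCompletion E) ^ 2 := by
      rw [huO]; push_cast; ring
    rwa [hcoe] at h0
  · rintro ⟨r, hr1, hur⟩
    set rO : 𝒪[w.1.adicCompletion E] := ⟨r, (v_le_one_iff_mem_integer r).1 hr1⟩ with hrO
    refine ⟨IsLocalRing.residue 𝒪[w.1.adicCompletion E] rO, ?_⟩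
    rw [← map_mul, ← sub_eq_zero, ← map_sub, IsLocalRing.residue_eq_zero_iff, hmem]
    have hcoe : (((uO - rO * rO : 𝒪[w.1.adicCompletion E])) : w.1.adicCompletion E) = u - r ^ 2 := by
      rw [huO, hrO]; push_cast; ring
    rw [hcoe]; exact hur

omit [NumberField F] [Algebra.IsQuadraticExtension F E] in
/-- **`hdres`**: a unit `η` with NON-square residue is not congruent to a square: `¬ |η − r²|_w < 1` for every `r ∈ 𝒪[E_w]`. [cite: SerreLocalFields1979, Ch. II §4 Prop. 7] -/
theorem not_valued_sub_sq_lt_one_of_not_isSquare_residue {η : w.1.adicCompletion E} (hη1 : Valued.v η = 1)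
    (hns : ¬ IsSquare (IsLocalRing.residue 𝒪[w.1.adicCompletion E] ⟨η, (v_le_one_iff_mem_integer η).1 hη1.le⟩))
    (r : w.1.adicCompletion E) (hr : Valued.v r ≤ 1) : ¬ Valued.v (η - r ^ 2) < 1 := fun h =>
  hns ((isSquare_residue_iff_exists_valued_sub_sq_lt_one E v w hη1).2 ⟨r, hr, h⟩)

/-! ## §2 Units: the criterion (U1), the dichotomy (U3) for all units, principal fixed units -/

include hc in
/-- **`hU1F`** — (U1) in valuation currency: a `σ_w`-fixed unit `g` is a norm `z·σ_w z` iff `|g − r²|_w < 1` for some `r ∈ 𝒪[E_w]`.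
[cite: SerreLocalFields1979, Ch. V §3 Prop. 5, Cor. 2] -/
theorem exists_mul_galAdicCompletionMap_eq_iff_exists_valued_sub_sq_lt_one_of_ramified (he : v.asIdeal.ramificationIdx' w.1.asIdeal ≠ 1)
    (h2 : Valued.v (2 : w.1.adicCompletion E) = 1) {g : w.1.adicCompletion E} (hg1 : Valued.v g = 1)
    (hσg : galAdicCompletionMap (L := E) c hw g = g) :
    (∃ z : w.1.adicCompletion E, z * galAdicCompletionMap (L := E) c hw z = g) ↔
      ∃ r : w.1.adicCompletion E, Valued.v r ≤ 1 ∧ Valued.v (g - r ^ 2) < 1 := by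
  rw [← isSquare_residue_iff_exists_valued_sub_sq_lt_one E v w hg1,
    ← exists_mul_galAdicCompletionMap_eq_iff_isSquare_residue_of_ramified E c hc v w hw he h2 hg1 hσg]
  constructor
  · rintro ⟨z, hz⟩
    exact ⟨z, valued_eq_one_of_mul_galAdicCompletionMap_valued_eq_one E c v w hw (by rw [hz]; exact hg1), hz⟩
  · rintro ⟨t, -, ht⟩
    exact ⟨t, ht⟩

include hc in
/-- **`hsqF`** — EVERY unit of `E_w` is residually `r²` or `r²·η` (`η` a fixed unit with non-square residue): `g ≡ g₊ := (g + σ_w g)∕2` (residual triviality of `σ_w`), `g₊` is a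
fixed unit, and (U3) writes `g₊ = t·σ_w t ≡ t²` or `g₊ = η·t·σ_w t ≡ η t²`. [cite: SerreLocalFields1979, Ch. V §3 Cor. 2] -/
theorem exists_valued_sub_sq_lt_one_or_of_ramified (he : v.asIdeal.ramificationIdx' w.1.asIdeal ≠ 1)
    (h2 : Valued.v (2 : w.1.adicCompletion E) = 1) {η : w.1.adicCompletion E} (hη1 : Valued.v η = 1)
    (hση : galAdicCompletionMap (L := E) c hw η = η)
    (hns : ¬ IsSquare (IsLocalRing.residue 𝒪[w.1.adicCompletion E] ⟨η, (v_le_one_iff_mem_integer η).1 hη1.le⟩))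
    (g : w.1.adicCompletion E) (hg1 : Valued.v g = 1) :
    ∃ r : w.1.adicCompletion E, Valued.v r ≤ 1 ∧ (Valued.v (g - r ^ 2) < 1 ∨ Valued.v (g - r ^ 2 * η) < 1) := by
  have h20 : (2 : w.1.adicCompletion E) ≠ 0 := fun h => by rw [h, map_zero] at h2; exact zero_ne_one h2
  have hσσ : ∀ y, galAdicCompletionMap (L := E) c hw (galAdicCompletionMap (L := E) c hw y) = y := fun y =>
    galAdicCompletionMap_galAdicCompletionMap_of_smul_eq c w hc hw y
  -- `g₊ := (g + σ g)∕2` is fixed and congruent to `g`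
  set gp : w.1.adicCompletion E := (g + galAdicCompletionMap (L := E) c hw g) / 2 with hgp
  have hσ2 : galAdicCompletionMap (L := E) c hw 2 = 2 := map_ofNat _ 2
  have hσgp : galAdicCompletionMap (L := E) c hw gp = gp := by
    rw [hgp, map_div₀, map_add, hσσ, hσ2, add_comm]
  have hres : Valued.v (galAdicCompletionMap (L := E) c hw g - g) < 1 := valued_galAdicCompletionMap_sub_lt_one_of_ramified E c v hc w hw he g hg1.le
  have hgpg : Valued.v (gp - g) < 1 := by
    have heq : gp - g = (galAdicCompletionMap (L := E) c hw g - g) / 2 := by rw [hgp]; field_simp; ring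
    rw [heq, map_div₀, h2, div_one]; exact hres
  have hgp1 : Valued.v gp = 1 := by
    have heq : gp = g + (gp - g) := by ring
    rw [heq, Valuation.map_add_eq_of_lt_left _ (by rw [hg1]; exact hgpg), hg1]
  -- (U3) on `g₊`
  obtain ⟨t, ht1, ht⟩ := exists_mul_galAdicCompletionMap_eq_or_of_ramified E c hc v w hw he h2 hη1 hση hns hgp1 hσgp
  have htt : Valued.v (t * galAdicCompletionMap (L := E) c hw t - t ^ 2) < 1 := by
    have heq : t * galAdicCompletionMap (L := E) c hw t - t ^ 2 = t * (galAdicCompletionMap (L := E) c hw t - t) := by ring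
    rw [heq, map_mul, ht1, one_mul]
    exact valued_galAdicCompletionMap_sub_lt_one_of_ramified E c v hc w hw he t ht1.le
  refine ⟨t, ht1.le, ?_⟩
  rcases ht with ht | ht
  · left
    have heq : g - t ^ 2 = (t * galAdicCompletionMap (L := E) c hw t - t ^ 2) - (gp - g) := by rw [ht]; ring
    rw [heq]
    exact lt_of_le_of_lt (Valuation.map_sub _ _ _) (max_lt htt hgpg)
  · right
    have heq : g - t ^ 2 * η = η * (t * galAdicCompletionMap (L := E) c hw t - t ^ 2) - (gp - g) := by rw [← ht]; ring
    rw [heq]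
    refine lt_of_le_of_lt (Valuation.map_sub _ _ _) (max_lt ?_ hgpg)
    rw [map_mul, hη1, one_mul]; exact htt

include hc in
/-- **`hprinc`** — a `σ_w`-fixed principal unit (`|x − 1|_w < 1`) is a norm `z·σ_w z` (its residue `1` is a square; (U1)). [cite: SerreLocalFields1979, Ch. V §3 Cor. 2] -/
theorem exists_mul_galAdicCompletionMap_eq_of_valued_sub_one_lt_one_of_ramified (he : v.asIdeal.ramificationIdx' w.1.asIdeal ≠ 1)
    (h2 : Valued.v (2 : w.1.adicCompletion E) = 1) {x : w.1.adicCompletion E}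
    (hσx : galAdicCompletionMap (L := E) c hw x = x) (hx : Valued.v (x - 1) < 1) :
    ∃ z : w.1.adicCompletion E, z * galAdicCompletionMap (L := E) c hw z = x := by
  have hx1 : Valued.v x = 1 := by
    have heq : x = 1 + (x - 1) := by ring
    rw [heq, Valuation.map_add_eq_of_lt_left _ (by rw [map_one]; exact hx), map_one]
  exact (exists_mul_galAdicCompletionMap_eq_iff_exists_valued_sub_sq_lt_one_of_ramified E c hc v w hw he h2 hx1 hσx).2
    ⟨1, by rw [map_one], by rw [one_pow]; exact hx⟩

/-! ## §3 Valuations: fixed elements have even order, anti-fixed odd -/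

include hc in
/-- **FIXED NON-ZERO ELEMENTS HAVE EVEN ORDER** at a tamely ramified non-split place: with `ϖ` anti-fixed of order `1`, `p·ϖ` is anti-fixed, of odd order
(★ `odd_log_valued_of_galAdicCompletionMap_eq_neg`). [cite: SerreLocalFields1979, Ch. IV §2 Prop. 5; Ch. III §6] -/
theorem even_log_valued_of_galAdicCompletionMap_eq_of_ramified (he : v.asIdeal.ramificationIdx' w.1.asIdeal ≠ 1)
    (h2 : Valued.v (2 : w.1.adicCompletion E) = 1) {ϖ : w.1.adicCompletion E} (hϖ : Valued.v ϖ = WithZero.exp (-1 : ℤ))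
    (hσϖ : galAdicCompletionMap (L := E) c hw ϖ = -ϖ) {p : w.1.adicCompletion E} (hp0 : p ≠ 0)
    (hσp : galAdicCompletionMap (L := E) c hw p = p) : Even (WithZero.log (Valued.v p)) := by
  have hϖ0 : ϖ ≠ 0 := fun h => by rw [h, map_zero] at hϖ; exact WithZero.zero_ne_coe hϖ
  have hσ : galAdicCompletionMap (L := E) c hw (p * ϖ) = -(p * ϖ) := by rw [map_mul, hσp, hσϖ, mul_neg]
  have hodd := odd_log_valued_of_galAdicCompletionMap_eq_neg E c hc w hw he h2 (mul_ne_zero hp0 hϖ0) hσ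
  rw [map_mul, WithZero.log_mul ((Valuation.ne_zero_iff _).2 hp0) ((Valuation.ne_zero_iff _).2 hϖ0), hϖ, WithZero.log_exp] at hodd
  rcases Int.even_or_odd (WithZero.log (Valued.v p)) with h | h
  · exact h
  · exfalso
    have h' : Even (WithZero.log (Valued.v p) + -1) := Odd.add_odd h (by decide)
    exact (Int.not_even_iff_odd.2 hodd) h'

include hc in
/-- **`hvalF`** — a fixed `p ≠ 0` has `|p|_w = |ϖ|_w^{2k}` for some `k ∈ ℤ`. [cite: SerreLocalFields1979, Ch. IV §2 Prop. 5] -/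
theorem exists_valued_eq_zpow_two_mul_of_galAdicCompletionMap_eq_of_ramified (he : v.asIdeal.ramificationIdx' w.1.asIdeal ≠ 1)
    (h2 : Valued.v (2 : w.1.adicCompletion E) = 1) {ϖ : w.1.adicCompletion E} (hϖ : Valued.v ϖ = WithZero.exp (-1 : ℤ))
    (hσϖ : galAdicCompletionMap (L := E) c hw ϖ = -ϖ) {p : w.1.adicCompletion E} (hp0 : p ≠ 0)
    (hσp : galAdicCompletionMap (L := E) c hw p = p) : ∃ k : ℤ, Valued.v p = Valued.v ϖ ^ (2 * k) := by
  obtain ⟨j, hj⟩ := even_log_valued_of_galAdicCompletionMap_eq_of_ramified E c hc v w hw he h2 hϖ hσϖ hp0 hσp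
  have hvp0 : Valued.v p ≠ 0 := (Valuation.ne_zero_iff _).2 hp0
  refine ⟨-j, ?_⟩
  rw [hϖ, ← WithZero.exp_zsmul, smul_eq_mul, ← WithZero.exp_log hvp0, hj]
  congr 1; ring

include hc in
/-- An ANTI-fixed `q ≠ 0` has `|q|_w = |ϖ|_w^{2k+1}` for some `k ∈ ℤ` (★ odd order). [cite: SerreLocalFields1979, Ch. IV §2 Prop. 5] -/
theorem exists_valued_eq_zpow_two_mul_add_one_of_galAdicCompletionMap_eq_neg_of_ramified (he : v.asIdeal.ramificationIdx' w.1.asIdeal ≠ 1)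
    (h2 : Valued.v (2 : w.1.adicCompletion E) = 1) {ϖ : w.1.adicCompletion E} (hϖ : Valued.v ϖ = WithZero.exp (-1 : ℤ))
    {q : w.1.adicCompletion E} (hq0 : q ≠ 0) (hσq : galAdicCompletionMap (L := E) c hw q = -q) :
    ∃ k : ℤ, Valued.v q = Valued.v ϖ ^ (2 * k + 1) := by
  obtain ⟨j, hj⟩ := odd_log_valued_of_galAdicCompletionMap_eq_neg E c hc w hw he h2 hq0 hσq
  have hvq0 : Valued.v q ≠ 0 := (Valuation.ne_zero_iff _).2 hq0
  refine ⟨-j - 1, ?_⟩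
  rw [hϖ, ← WithZero.exp_zsmul, smul_eq_mul, ← WithZero.exp_log hvq0, hj]
  congr 1; ring

include hc in
/-- **`hfixval`** — a fixed `p ≠ 0` and an anti-fixed `q ≠ 0` have DIFFERENT valuations (even versus odd order). [cite: SerreLocalFields1979, Ch. IV §2 Prop. 5] -/
theorem valued_ne_of_galAdicCompletionMap_eq_of_eq_neg_of_ramified (he : v.asIdeal.ramificationIdx' w.1.asIdeal ≠ 1)
    (h2 : Valued.v (2 : w.1.adicCompletion E) = 1) {ϖ : w.1.adicCompletion E} (hϖ : Valued.v ϖ = WithZero.exp (-1 : ℤ))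
    (hσϖ : galAdicCompletionMap (L := E) c hw ϖ = -ϖ) {p q : w.1.adicCompletion E} (hp0 : p ≠ 0) (hq0 : q ≠ 0)
    (hσp : galAdicCompletionMap (L := E) c hw p = p) (hσq : galAdicCompletionMap (L := E) c hw q = -q) :
    Valued.v p ≠ Valued.v q := by
  obtain ⟨k, hk⟩ := exists_valued_eq_zpow_two_mul_of_galAdicCompletionMap_eq_of_ramified E c hc v w hw he h2 hϖ hσϖ hp0 hσp
  obtain ⟨k', hk'⟩ := exists_valued_eq_zpow_two_mul_add_one_of_galAdicCompletionMap_eq_neg_of_ramified E c hc v w hw he h2 hϖ hq0 hσq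
  intro h
  rw [hk, hk', hϖ, ← WithZero.exp_zsmul, ← WithZero.exp_zsmul, smul_eq_mul, smul_eq_mul] at h
  have h' := WithZero.exp_injective h
  omega

/-! ## §4 `hnormF`: a fixed `f ≠ 0` is a norm up to the class of `η` -/

include hc in
/-- **`hnormF`** — for `f ≠ 0` fixed by `σ_w` there is `z` with `z·σ_w z·f = 1` or `z·σ_w z·f = η`: writing `|f| = exp(2j)`, the element `g := f·(ϖ·σ_w ϖ)^j` is a fixed
UNIT, so (U3) `g = t·σ_w t` or `g = η·t·σ_w t`, and `(ϖ σ_w ϖ)^j = ϖ^j·σ_w(ϖ^j)` is a norm.  (`E_w^{σ,×} ∕ N` has order `2`, generated by `η`.)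
[cite: SerreLocalFields1979, Ch. V §3 Cor. 2] [cite: Neukirch1999, Ch. V (1.2)] -/
theorem exists_mul_galAdicCompletionMap_mul_eq_one_or_eq_of_ramified (he : v.asIdeal.ramificationIdx' w.1.asIdeal ≠ 1)
    (h2 : Valued.v (2 : w.1.adicCompletion E) = 1) {η : w.1.adicCompletion E} (hη1 : Valued.v η = 1)
    (hση : galAdicCompletionMap (L := E) c hw η = η)
    (hns : ¬ IsSquare (IsLocalRing.residue 𝒪[w.1.adicCompletion E] ⟨η, (v_le_one_iff_mem_integer η).1 hη1.le⟩))
    {ϖ : w.1.adicCompletion E} (hϖ : Valued.v ϖ = WithZero.exp (-1 : ℤ)) (hσϖ : galAdicCompletionMap (L := E) c hw ϖ = -ϖ)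
    (f : w.1.adicCompletion E) (hf0 : f ≠ 0) (hσf : galAdicCompletionMap (L := E) c hw f = f) :
    ∃ z : w.1.adicCompletion E, z * galAdicCompletionMap (L := E) c hw z * f = 1 ∨ z * galAdicCompletionMap (L := E) c hw z * f = η := by
  have hσσ : ∀ y, galAdicCompletionMap (L := E) c hw (galAdicCompletionMap (L := E) c hw y) = y := fun y =>
    galAdicCompletionMap_galAdicCompletionMap_of_smul_eq c w hc hw y
  have hϖ0 : ϖ ≠ 0 := fun h => by rw [h, map_zero] at hϖ; exact WithZero.zero_ne_coe hϖ
  obtain ⟨j, hj⟩ := even_log_valued_of_galAdicCompletionMap_eq_of_ramified E c hc v w hw he h2 hϖ hσϖ hf0 hσf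
  -- the fixed norm `ν := ϖ·σϖ` of order `2` and the fixed unit `g := f·ν^j`
  set ν : w.1.adicCompletion E := ϖ * galAdicCompletionMap (L := E) c hw ϖ with hν
  have hν0 : ν ≠ 0 := by rw [hν, hσϖ]; exact mul_ne_zero hϖ0 (neg_ne_zero.2 hϖ0)
  have hσν : galAdicCompletionMap (L := E) c hw ν = ν := by rw [hν, map_mul, hσσ, mul_comm]
  have hvν : Valued.v ν = WithZero.exp (-2 : ℤ) := by
    rw [hν, hσϖ, mul_neg, Valuation.map_neg, map_mul, hϖ, ← WithZero.exp_add]; norm_num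
  set g : w.1.adicCompletion E := f * ν ^ j with hg
  have hσg : galAdicCompletionMap (L := E) c hw g = g := by rw [hg, map_mul, map_zpow₀, hσf, hσν]
  have hvf0 : Valued.v f ≠ 0 := (Valuation.ne_zero_iff _).2 hf0
  have hg1 : Valued.v g = 1 := by
    rw [hg, map_mul, map_zpow₀, hvν, ← WithZero.exp_log hvf0, hj, ← WithZero.exp_zsmul, ← WithZero.exp_add, ← WithZero.exp_zero]
    congr 1; simp only [smul_eq_mul]; ring
  obtain ⟨t, ht1, ht⟩ := exists_mul_galAdicCompletionMap_eq_or_of_ramified E c hc v w hw he h2 hη1 hση hns hg1 hσg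
  have ht0 : t ≠ 0 := fun h => by rw [h, map_zero] at ht1; exact zero_ne_one ht1
  have hσt0 : galAdicCompletionMap (L := E) c hw t ≠ 0 := fun h => ht0 (by rw [← hσσ t, h, map_zero])
  have hσϖ0 : galAdicCompletionMap (L := E) c hw ϖ ≠ 0 := by rw [hσϖ]; exact neg_ne_zero.2 hϖ0
  -- `ν^j = ϖ^j · σ(ϖ^j)`, so `f = g · ν^{−j}` is `N(t ϖ^{−j})` or `η · N(t ϖ^{−j})`
  have hνj : ν ^ j = ϖ ^ j * galAdicCompletionMap (L := E) c hw (ϖ ^ j) := by rw [hν, mul_zpow, map_zpow₀]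
  have hfg : f = g * (ν ^ j)⁻¹ := by rw [hg, mul_inv_cancel_right₀ (zpow_ne_zero j hν0)]
  refine ⟨(t * ϖ ^ (-j))⁻¹, ?_⟩
  rcases ht with ht | ht
  · left
    rw [hfg, ← ht, hνj, map_inv₀, map_mul, map_zpow₀, map_zpow₀, zpow_neg, zpow_neg]
    field_simp
  · right
    rw [hfg, ← ht, hνj, map_inv₀, map_mul, map_zpow₀, map_zpow₀, zpow_neg, zpow_neg]
    field_simp

end Literature.NumberTheory.LocalFields.RamifiedPlaceNormDictionary

end
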